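import Summits.QuantumFields.BalabanUV.Beta.FP.TowerQN1RowJet
import Summits.QuantumFields.BalabanUV.Beta.FP.TorusCompositeVertexJunctionSym
import Summits.QuantumFields.BalabanUV.Beta.NVertexParities

/-!
# `BalabanUV.Beta.FP.TowerQN1Row` — road «FP», binder row D1, ROUTE T (β1), (E4e): **THE END WRAPPER's CONTENT ROW `hQN₁` AT ONE DIRECTION, FROM THE ROAD's DATA** —
# with v4's 𝔔-side letters `hQ₁₀ hQ₂₀ hQ₁₁f hQ₂₁f h𝔔₀ h𝔔₁ h𝔔′₁f` displayed as values, the free coarse read-out INSTANTIATED as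
# `Xbf v := c • diagonal (lv v ∘ itRoot^{ρ_c} (n+2) ∘ fst)` (R-FP-79 ∕ J-NOTE-4), the slot map `fN a = (wrapPt T (Lc^(n+2)•a.1), inr a.2)`, the (J-W″) letter `hJW` at `r := 1`
# and the linearity rows `hhvl ∕ hlv`: `𝔔′₁f (r•e_a) = (perF T (dper T (VN (Roots.ctr Lc) Pn (n+1) (μN a) (yN a)))).submatrix fN (·♭)` GIVEN ONLY the pin
# `hr : (−2c)·r = Pn.cE (n+2)` and the LOCK ROW `hcVH : 2·Pn.cVH (n+2) = −(Π_{ℓ<n+2} stepScale 3 Lc ℓ·Lc⁴)·Pn.cE (n+2)` (RULING R-D1-g66-1, an2 g66 J-NOTE-4)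

WHY (`HOME/b2b-balaban-beta-d1-p3/g42/SPEC-53.md`; an2 g66 J-NOTE-4 l.67584 ∕ A-1 l.67586 — the chain (E4e-1…7), with the row's NOT-TO-FILE certificate
`HOME/b2b-balaban-beta-an2/gen66/cert/J4-Qside-chain-is-compIns1Sym.NOT-TO-FILE.lean` fcb8f993af7598be whose steps (a)(b)(c)(e)(f)(g) §1–§2 ADAPT, with credit).
(E4e-1) v4's five 𝔔-letters make `𝔔₁f v = c • compIns₁Sym Lc M (fun i => n+1−(i−1)) ρ_c (n+2) (hv v)` (leaf-02 C2-Sym's (n+2)-fold jet, top peel `rfl`) and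
`𝔔₀ = compRowsSym … (n+2)`; with `Xbf` so instantiated, an2 g66 `TorusCompositeIndexWardOneSym.compIns₁Sym_pureGauge_fun` + leaf-02 `compIns₁Sym_add` turn `h𝔔′₁f` into
`𝔔′₁f v = c • compIns₁Sym … (hv v + tgrad·lv v)` — NO gauge residue; (E4e-2) (J-W″) at `r := 1` + homogeneity: `hv (r•e_a) + tgrad·lv (r•e_a) = r • colN̂_a`;
(E4e-3) F4-Sym `TorusCompositeVertexJunctionSym.sum_mul_perZ_dper_compVhS_eq_compIns₁Sym_apply` (leaf-02 g32) writes every entry of `compIns₁Sym … (n+2) colN̂_a` as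
`Σ_b colN̂_a b·perZ T (dper T (Σ_full • compV (Roots.ctr Lc).r Lc (n+2) b.2 b.1)) (Lc^(n+2)•x̄) z (inr κ) (inl β)` (unit `Σ_full`, `compV = compVhS ℓˢ 𝓋ˢ` by `rfl`);
(E4e-4∕5) `Σ_full` out (`dper_smul ∕ perZ_smul`), the slot bridge `perZ T (dper T ·) (Lc^(n+2)•x̄) = perF T (dper T ·) (fN (x̄,κ))` (first-argument periodicity from
`dper_translate`), an2 PART 11 `NVertexSectorsPeriodised.perF_dper_VbN_eq_sum` (the 𝔔-fold); (E4e-6) an2 PART 12 `NVertexParities.perF_dper_VN_submatrix_of_inr_inl`;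
(E4e-7) `c·r·Σ_full = Pn.cVH (n+2)` from `hr` + `hcVH`.

WHAT ([folklore] `Matrix`∕`Finset`∕`tsum` bookkeeping BY NAME; no `def`, no `def … : Prop`, nothing cited, 0 sorry; §1–§2 of the chain = `FP/TowerQN1RowJet`):
§3 `compIns1Sym_apply_eq_sigmaFull_mul_sum` (F4-Sym at a bond weight, `Σ_full` out), `perZ_dper_wrapPt_left` (the slot bridge), `sum_col_mul_perF_dper_compV_apply` (an2 PART 11's
fold entrywise on the wrapper's finest torus), `lockVH_scalar` (`c·r·Σ_full = cVH` from `hr` + `hcVH`); §4 **`Qprime1_eq_smul_compIns1Sym_col`** (`𝔔′₁f (r•e_a) = (c·r) •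
compIns₁Sym … (n+2) colN̂_a`), **`hQN1_of_road_data`**.
Displayed letters left (all the instantiation's): `hhvl ∕ hlv ∕ hJW` (as `TowerHN1Row`), v4's `hQ₁₀ hQ₂₀ hQ₁₁f hQ₂₁f h𝔔₀ h𝔔₁ h𝔔′₁f` (values), `hXbf` (THE instantiation of
R-FP-79's free `Xbf`), `hfN`, `hc`, and the two scalar rows `hr` ∕ `hcVH`.
WHAT THIS IS NOT: not the wrapper's `hQN₁` FAMILY (`∀ n μ y B`) — one direction label; not `hJW`'s instantiation (g39 #5); not the value of `Pn.cVH` (the row `hcVH` of the (C1)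
instantiation, R-D1-g66-1); not second order (`hHN₂ ∕ hQN₂`); nothing of Bałaban's asserted, valued or discharged; 0 estimates; 0∕4 row-D1 binders (hW, hR, D1Tel, D1Rep);
ROOT M‴ p325680 ∕ P5c ∕ D6 untouched; NOT (C1), NOT (L2′), NOT (T-ID), NOT SDF, NOT D1, NEVER «G-an2-4 closed», NOT BetaPertH, NOT continuum, NOT Clay.

HONEST DEPENDENCY (page 1, mandatory): continuum YM on T⁴ ⇐ BetaPertH ∧ nine spine estimates (0/9 proved); BetaPertH ⇐ (D1) ∧ (D4) ∧ CAP+tail;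
G-an2-4 gates asym, D1 and NE2/3/4.  HONEST FRAMING (cell contract, verbatim): «discharging `BetaPertH` makes Bałaban's UV stability UNCONDITIONAL —
a real constructive-QFT result; it is NOT the continuum limit and NOT the Clay problem.»  ABSOLUTE RULE (cell charter, verbatim): «No internally-minted
statement may enter as a cited fact. Every hypothesis is either kernel-proved in this package or a verbatim quotation of a PUBLISHED theorem with page
reference. The manuscript(s) under audit are NOT citable for their own disputed steps — they are the thing under adjudication; programme-internal
(2001/route/tribunal) claims are never citable.»  Road «FP» OWNER, b2b-balaban-beta-d1-p3 gen 42, 2026-08-27.  No existing file touched.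
-/

noncomputable section

open scoped BigOperators

namespace Summit.QuantumFields.BalabanUV.Beta.FP.TowerQN1Row

open Finset Matrix
open Literature.MathematicalPhysics.QuantumFieldTheory
open Literature.MathematicalPhysics.QuantumFieldTheory.Balaban1983to89
open Literature.MathematicalPhysics.QuantumFieldTheory.Balaban1983to89.Beta
open B4TorusKernel.MultiPeriod (translate)
open B5Prop11Plancherel (fine)
open B6Lemma24Torus (pbox wrap)
open AffineAveraging (Site box toSite)
open AveragingContoursRooted (ctr ctrOff)
open ExpKernelCalculus (MKer)
open OneStepResolventKernel (Fib)
open OneStepKernelFamily (vertexOfK)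
open Summit.QuantumFields.BalabanUV.Beta.BorderedHessian (stepScale)
open Summit.QuantumFields.BalabanUV.Beta.SymShiftedSpread (bhKStepSh)
open Summit.QuantumFields.BalabanUV.Beta.DshAn1 (Dsh)
open Summit.QuantumFields.BalabanUV.Beta.SymAveragingHessianCounts (symLinKerAt symVhKerAt symVhSAt)
open Summit.QuantumFields.BalabanUV.Beta.CompositeVertexKernelRec (compVhS)
open Summit.QuantumFields.BalabanUV.Beta.CompositeOneShotJets (compV)
open Summit.QuantumFields.BalabanUV.Beta.CompositeOneShotJetData (Roots Pins AN VN)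
open Summit.QuantumFields.BalabanUV.Beta.FP.KernelPeriodisationFib (Idx perF perZ perF_apply perZ_smul perZ_translate_left)
open Summit.QuantumFields.BalabanUV.Beta.FP.KernelPeriodisationFibLoc (dper dper_translate)
open Summit.QuantumFields.BalabanUV.Beta.FP.PeriodisedBorderTables (dper_smul)
open Summit.QuantumFields.BalabanUV.Beta.GAN24.KernelPeriodisation (quo translate_wrap_quo)
open Summit.QuantumFields.BalabanUV.Beta.FP.TorusGaugeCovariance (tgrad)
open Summit.QuantumFields.BalabanUV.Beta.FP.TorusGaugeCovariancePairing (wrapPt wrapPt_coe)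
open Summit.QuantumFields.BalabanUV.Beta.FP.TorusGaugeCovarianceCoarse (coarsePt)
open Summit.QuantumFields.BalabanUV.Beta.FP.TorusCompositeObjects (towerTorus)
open Summit.QuantumFields.BalabanUV.Beta.FP.TorusCompositeObjectsG (QstepSym compRowsSym)
open Summit.QuantumFields.BalabanUV.Beta.FP.TorusCompositeCovariance (itRoot)
open Summit.QuantumFields.BalabanUV.Beta.FP.TorusStepInsertionSym (stepIns₁Sym)
open Summit.QuantumFields.BalabanUV.Beta.FP.TorusCompositeCovarianceOneSym (compIns₁Sym)
open Summit.QuantumFields.BalabanUV.Beta.FP.TorusCompositeCovarianceTwoPolarSym (compIns₁Sym_smul)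
open Summit.QuantumFields.BalabanUV.Beta.FP.TowerQN1RowJet (Qf1_eq_compIns1Sym Q0_eq_compRowsSym unit_eq_sigmaFull sigmaFull_card_eq Qprime1_eq_compIns1Sym_along_sum
  direction_add_exact_eq_smul_col)
open Summit.QuantumFields.BalabanUV.Beta.FP.TorusCompositeVertexJunctionSym (sum_mul_perZ_dper_compVhS_eq_compIns₁Sym_apply)
open Summit.QuantumFields.BalabanUV.Beta.NVertexSectorsPeriodised (perF_dper_VbN_eq_sum dvd_towerTorus_fine)
open Summit.QuantumFields.BalabanUV.Beta.NVertexParities (perF_dper_VN_submatrix_of_inr_inl)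
open Summit.QuantumFields.BalabanUV.Beta.FP.TowerWeightWords (card_box_four)
open Summit.QuantumFields.BalabanUV.Beta.FP.TowerHN1Row (map_smul_of_linear)

variable {Lc : ℕ} [NeZero Lc] (M : Fin (3 + 1) → ℕ) [∀ μ, NeZero (M μ)] (n : ℕ) (c : ℝ)

/-! ## §3 F4-Sym at the column; the slot bridge; PART 11's fold entrywise; the lock scalar -/

section Fold

variable (hc : ctrOff (3 + 1) Lc ∈ box (3 + 1) Lc)

include hc in
/-- [folklore] **`compIns1Sym_apply_eq_sigmaFull_mul_sum` — F4-Sym AT A BOND WEIGHT, `Σ_full` OUT**: every (multiplier, field) entry of C2-Sym's (n+2)-fold jet along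
`h` is `Σ_full · Σ_b h b · perZ T (dper T (compV (Roots.ctr Lc).r Lc (n+2) b.2 b.1)) (Lc^(n+2)•x̄) z (inr κ) (inl β)` (leaf-02 g32 F4-Sym
`sum_mul_perZ_dper_compVhS_eq_compIns₁Sym_apply` VERBATIM at `lev := fun i => n+1−(i−1)`; `compV … = compVhS ℓˢ 𝓋ˢ …` by `rfl`; `dper_smul`, `perZ_smul`; `unit_eq_sigmaFull`). -/
theorem compIns1Sym_apply_eq_sigmaFull_mul_sum (h : ↥(pbox (towerTorus Lc (fine Lc M) (n + 1))) × Fin (3 + 1) → ℝ)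
    (x : ↥(pbox M)) (κ : Fin (3 + 1)) (z : ↥(pbox (towerTorus Lc (fine Lc M) (n + 1)))) (β : Fin (3 + 1)) :
    compIns₁Sym Lc M (fun i : ℕ => n + 1 - (i - 1)) (fun _ : ℕ => ctrOff (3 + 1) Lc) (n + 1 + 1) h (x, κ) (z, β)
      = (∏ ℓ ∈ range (n + 1 + 1), (stepScale 3 Lc ℓ * ((box (3 + 1) Lc).card : ℝ))) *
          ∑ b : ↥(pbox (towerTorus Lc (fine Lc M) (n + 1))) × Fin (3 + 1), h b *
            perZ (towerTorus Lc (fine Lc M) (n + 1)) (dper (towerTorus Lc (fine Lc M) (n + 1))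
              (compV (Roots.ctr Lc).r Lc (n + 1 + 1) b.2 (b.1 : Site (3 + 1))))
              ((((Lc ^ (n + 1 + 1) : ℕ) : ℤ)) • (x : Site (3 + 1))) (z : Site (3 + 1)) (Sum.inr κ) (Sum.inl β) := by
  -- F4-Sym VERBATIM (an2 J-NOTE-4 (c)), read at the wrapper's spelling of the finest torus
  have key : compIns₁Sym Lc M (fun i : ℕ => n + 1 - (i - 1)) (fun _ : ℕ => ctrOff (3 + 1) Lc) (n + 1 + 1) h (x, κ) (z, β)
      = ∑ b : ↥(pbox (towerTorus Lc (fine Lc M) (n + 1))) × Fin (3 + 1), h b *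
          perZ (towerTorus Lc (fine Lc M) (n + 1)) (dper (towerTorus Lc (fine Lc M) (n + 1))
            ((((∏ i ∈ range (n + 1 + 1), stepScale 3 Lc ((fun i : ℕ => n + 1 - (i - 1)) (i + 1))) * ((box (3 + 1) Lc).card : ℝ) ^ (n + 1 + 1))) •
              compVhS (fun _ : ℕ => symLinKerAt (ctr (3 + 1) Lc) Lc) (fun _ : ℕ => symVhKerAt (ctr (3 + 1) Lc) Lc) Lc (n + 1 + 1) b.2 (b.1 : Site (3 + 1))))
            ((((Lc ^ (n + 1 + 1) : ℕ) : ℤ)) • (x : Site (3 + 1))) (z : Site (3 + 1)) (Sum.inr κ) (Sum.inl β) :=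
    (sum_mul_perZ_dper_compVhS_eq_compIns₁Sym_apply Lc hc (n + 1 + 1) M (fun i : ℕ => n + 1 - (i - 1)) (fun _ : ℕ => ctrOff (3 + 1) Lc) h x κ z β).symm
  rw [key, unit_eq_sigmaFull, Finset.mul_sum]
  refine Finset.sum_congr rfl fun b _ => ?_
  rw [show compV (Roots.ctr Lc).r Lc (n + 1 + 1) b.2 (b.1 : Site (3 + 1))
      = compVhS (fun _ : ℕ => symLinKerAt (ctr (3 + 1) Lc) Lc) (fun _ : ℕ => symVhKerAt (ctr (3 + 1) Lc) Lc) Lc (n + 1 + 1) b.2 (b.1 : Site (3 + 1)) from rfl,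
    dper_smul, perZ_smul]
  simp only [Pi.smul_apply, smul_eq_mul]
  ring

omit [NeZero Lc] in
/-- [folklore] **`perZ_dper_wrapPt_left` — THE SLOT BRIDGE**: the periodised diagonal periodisation is `T`-periodic in its FIRST site argument too (`dper_translate` +
`perZ_translate_left`), so it may be read at the box representative `wrapPt T s` (`translate_wrap_quo`). -/
theorem perZ_dper_wrapPt_left (T : Fin (3 + 1) → ℕ) [∀ i, NeZero (T i)] (K : MKer (3 + 1) (Fib 3)) (s z : Site (3 + 1)) (e e' : Fib 3) :
    perZ T (dper T K) ((wrapPt T s : ↥(pbox T)) : Site (3 + 1)) z e e' = perZ T (dper T K) s z e e' := by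
  conv_rhs => rw [← translate_wrap_quo T s]
  rw [wrapPt_coe]
  exact (perZ_translate_left T (K := dper T K) (fun m x y a b => dper_translate T K m x y a b) (wrap T s) z (quo T s) e e').symm

/-- [folklore] **`sum_col_mul_perF_dper_compV_apply` — an2 PART 11's 𝔔-FOLD, ENTRYWISE, ON THE WRAPPER's FINEST TORUS** (`NVertexSectorsPeriodised.perF_dper_VbN_eq_sum` at
`j := n+1`, `M := T`, `hM := dvd_towerTorus_fine`): `Σ_b colN̂ b · perF T (dper T (compV (Roots.ctr Lc).r Lc (n+2) b.2 b.1)) p q = perF T (dper T (𝒱bN (μ,y))) p q`. -/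
theorem sum_col_mul_perF_dper_compV_apply (μ : Fin (3 + 1)) (y : Site (3 + 1)) (p q : Idx (towerTorus Lc (fine Lc M) (n + 1)) (Fib 3)) :
    ∑ b : ↥(pbox (towerTorus Lc (fine Lc M) (n + 1))) × Fin (3 + 1),
        perF (towerTorus Lc (fine Lc M) (n + 1)) (AN (Roots.ctr Lc) (n + 1)) (b.1, Sum.inl b.2)
            (wrapPt (towerTorus Lc (fine Lc M) (n + 1)) (((Lc ^ (n + 1 + 1) : ℕ) : ℤ) • y), Sum.inr μ)
          * perF (towerTorus Lc (fine Lc M) (n + 1)) (dper (towerTorus Lc (fine Lc M) (n + 1))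
              (compV (Roots.ctr Lc).r Lc (n + 1 + 1) b.2 (b.1 : Site (3 + 1)))) p q
      = perF (towerTorus Lc (fine Lc M) (n + 1)) (dper (towerTorus Lc (fine Lc M) (n + 1))
          (vertexOfK (AN (Roots.ctr Lc) (n + 1)) (Lc ^ (n + 1 + 1)) (compV (Roots.ctr Lc).r Lc (n + 1 + 1)) μ y)) p q := by
  rw [perF_dper_VbN_eq_sum (Roots.ctr Lc) (n + 1) (towerTorus Lc (fine Lc M) (n + 1)) (dvd_towerTorus_fine M n) μ y, Matrix.sum_apply]
  exact Finset.sum_congr rfl fun b _ => by rw [Matrix.smul_apply, smul_eq_mul]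

omit [NeZero Lc] [∀ μ, NeZero (M μ)] in
/-- [folklore] **`lockVH_scalar` — THE 𝔔-SIDE SCALAR FROM THE PIN AND THE LOCK ROW** (R-D1-g66-1): `(−2c)·r = cE` and `2·cVH = −Σ_full·cE` give `c·r·Σ_full = cVH`. -/
theorem lockVH_scalar (r cE cVH S : ℝ) (hr : (-2 * c) * r = cE) (hcVH : 2 * cVH = -(S * cE)) : c * r * S = cVH := by
  linear_combination (-(S / 2)) * hr - (1 / 2 : ℝ) * hcVH

end Fold

/-! ## §4 The row `hQN₁` at one direction -/

section Row

variable (P : Pins) (hc : ctrOff (3 + 1) Lc ∈ box (3 + 1) Lc)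
  {κ : Type*} [Fintype κ] [DecidableEq κ] (yN : κ → Site (3 + 1)) (μN : κ → Fin (3 + 1))
  -- the nested column and its tree-gauge read-out (v4's `hv ∕ hhvl ∕ lv ∕ hlv`) and the (J-W″) letter at `r := 1` (as `TowerHN1Row`)
  (hv : (κ → ℝ) → (↥(pbox (towerTorus Lc (fine Lc M) (n + 1))) × Fin (3 + 1) → ℝ))
  (hhvl : ∀ (r : ℝ) (x y : κ → ℝ), hv (r • x + y) = r • hv x + hv y)
  (lv : (κ → ℝ) → ↥(pbox (towerTorus Lc (fine Lc M) (n + 1))) → ℝ)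
  (hlv : ∀ (r : ℝ) (x y : κ → ℝ), lv (r • x + y) = r • lv x + lv y)
  (hJW : ∀ (a : κ) (b : ↥(pbox (towerTorus Lc (fine Lc M) (n + 1))) × Fin (3 + 1)), hv (Pi.single a 1) b
      = perF (towerTorus Lc (fine Lc M) (n + 1)) (AN (Roots.ctr Lc) (n + 1)) (b.1, Sum.inl b.2)
          (wrapPt (towerTorus Lc (fine Lc M) (n + 1)) (((Lc ^ (n + 1 + 1) : ℕ) : ℤ) • yN a), Sum.inr (μN a))
        - ∑ s : ↥(pbox (towerTorus Lc (fine Lc M) (n + 1))), tgrad (towerTorus Lc (fine Lc M) (n + 1)) (b.1, Sum.inl b.2) s * lv (Pi.single a 1) s)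
  -- v4's 𝔔-side letters VERBATIM (`Mc B ↦ M`, `c n ↦ c`, `hv n B ↦ hv`; the coarse source type `κ B ↦ κ` feeds `hv`, the matrix rows are `pbox M × Fin 4`)
  (Q₁₀ : Matrix (↥(pbox (fine Lc M)) × Fin (3 + 1)) (↥(pbox (towerTorus Lc (fine Lc M) (n + 1))) × Fin (3 + 1)) ℝ)
  (hQ₁₀ : Q₁₀ = compRowsSym Lc (fine Lc M) (fun i : ℕ => n + 1 - i) (fun _ : ℕ => ctrOff (3 + 1) Lc) (n + 1))
  (Q₂₀ : Matrix (↥(pbox M) × Fin (3 + 1)) (↥(pbox (fine Lc M)) × Fin (3 + 1)) ℝ)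
  (hQ₂₀ : Q₂₀ = (perF (fine Lc M) (bhKStepSh 3 Lc (Dsh Lc) ((n + 1 - 0)))).submatrix
    (fun a : ((↥(pbox M) × Fin (3 + 1))) => ((coarsePt M Lc a.1, Sum.inr (a.2)) : Idx (fine Lc M) (Fib 3)))
    (fun b : (↥(pbox (fine Lc M)) × Fin (3 + 1)) => ((b.1, Sum.inl b.2) : Idx (fine Lc M) (Fib 3))))
  (Q₁₁f : (κ → ℝ) → Matrix (↥(pbox (fine Lc M)) × Fin (3 + 1)) (↥(pbox (towerTorus Lc (fine Lc M) (n + 1))) × Fin (3 + 1)) ℝ)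
  (hQ₁₁f : ∀ v, Q₁₁f v = c • compIns₁Sym Lc (fine Lc M) (fun i : ℕ => n + 1 - i) (fun _ : ℕ => ctrOff (3 + 1) Lc) (n + 1) (hv v))
  (Q₂₁f : (κ → ℝ) → Matrix ((↥(pbox M) × Fin (3 + 1))) (↥(pbox (fine Lc M)) × Fin (3 + 1)) ℝ)
  (hQ₂₁f : ∀ v, Q₂₁f v = ∑ a' : (↥(pbox (fine Lc M)) × Fin (3 + 1)), ((c * (((Lc : ℝ) ^ (3 + 1) * stepScale 3 Lc ((n + 1 - 0))) *
      (∏ i ∈ range (n + 1), (stepScale 3 Lc ((n + 1 - (i + 1))) * ((box (3 + 1) Lc).card : ℝ)))⁻¹)) *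
      (compRowsSym Lc (fine Lc M) (fun i : ℕ => n + 1 - i) (fun _ : ℕ => ctrOff (3 + 1) Lc) (n + 1) *ᵥ (hv v)) a') •
      (perF (fine Lc M) (dper (fine Lc M) (symVhSAt (ctr (3 + 1) Lc) 3 Lc rfl a'.2 (a'.1 : Site (3 + 1))))).submatrix
        (fun k : (↥(pbox M) × Fin (3 + 1)) => (((coarsePt M Lc k.1, Sum.inr (k.2)) : Idx (fine Lc M) (Fib 3))))
        (fun b : (↥(pbox (fine Lc M)) × Fin (3 + 1)) => ((b.1, Sum.inl b.2) : Idx (fine Lc M) (Fib 3))))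
  (𝔔₀ : Matrix ((↥(pbox M) × Fin (3 + 1))) (↥(pbox (towerTorus Lc (fine Lc M) (n + 1))) × Fin (3 + 1)) ℝ)
  (h𝔔₀ : Q₂₀ * Q₁₀ = 𝔔₀)
  (𝔔₁f : (κ → ℝ) → Matrix ((↥(pbox M) × Fin (3 + 1))) (↥(pbox (towerTorus Lc (fine Lc M) (n + 1))) × Fin (3 + 1)) ℝ)
  (h𝔔₁ : ∀ v, Q₂₁f v * Q₁₀ + Q₂₀ * Q₁₁f v = 𝔔₁f v)
  (Xbf : (κ → ℝ) → Matrix ((↥(pbox M) × Fin (3 + 1))) ((↥(pbox M) × Fin (3 + 1))) ℝ)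
  -- THE INSTANTIATION of R-FP-79's free coarse read-out (J-NOTE-4 ∕ R-D1-g66-1 (iii))
  (hXbf : ∀ v, Xbf v = c • Matrix.diagonal (fun a : (↥(pbox M) × Fin (3 + 1)) =>
    lv v (itRoot Lc M (fun _ : ℕ => ctrOff (3 + 1) Lc) (fun _ => hc) (n + 1 + 1) a.1)))
  (𝔔'₁f : (κ → ℝ) → Matrix ((↥(pbox M) × Fin (3 + 1))) (↥(pbox (towerTorus Lc (fine Lc M) (n + 1))) × Fin (3 + 1)) ℝ)
  (h𝔔'₁f : ∀ v, 𝔔'₁f v = Xbf v * 𝔔₀ + 𝔔₁f v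
    + 𝔔₀ * (-(c • Matrix.diagonal (fun b : (↥(pbox (towerTorus Lc (fine Lc M) (n + 1))) × Fin (3 + 1)) => lv v b.1))))
  -- the slot map of the N one-shot system at the coarse multiplier slots (v4's `fN n B`; displayed)
  (fN : (↥(pbox M) × Fin (3 + 1)) → Idx (towerTorus Lc (fine Lc M) (n + 1)) (Fib 3))
  (hfN : ∀ a : ↥(pbox M) × Fin (3 + 1),
    fN a = (wrapPt (towerTorus Lc (fine Lc M) (n + 1)) (((Lc ^ (n + 1 + 1) : ℕ) : ℤ) • (a.1 : Site (3 + 1))), Sum.inr a.2))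
  -- the pinned direction `dv = r•e_a`: the pin `(−2c)·r = cE (n+2)` (R-FP-79) and the LOCK ROW `hcVH` (R-D1-g66-1)
  (r : ℝ) (hr : (-2 * c) * r = P.cE (n + 1 + 1))
  (hcVH : 2 * P.cVH (n + 1 + 1) = -((∏ ℓ ∈ range (n + 1 + 1), (stepScale 3 Lc ℓ * (Lc : ℝ) ^ (3 + 1))) * P.cE (n + 1 + 1))) (a : κ)

omit [Fintype κ] in
include hhvl hlv hJW hQ₁₀ hQ₂₀ hQ₁₁f hQ₂₁f h𝔔₀ h𝔔₁ hXbf h𝔔'₁f in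
/-- [folklore] **`Qprime1_eq_smul_compIns1Sym_col`**: along the pinned direction the wrapper's conjugated 𝔔-side jet IS `(c·r) •` the (n+2)-fold composite jet along the torus
ℋ-column of the source `a` (§1 + §2 + `compIns₁Sym_smul`). -/
theorem Qprime1_eq_smul_compIns1Sym_col :
    𝔔'₁f (r • (Pi.single a (1 : ℝ) : κ → ℝ)) = (c * r) • compIns₁Sym Lc M (fun i : ℕ => n + 1 - (i - 1)) (fun _ : ℕ => ctrOff (3 + 1) Lc) (n + 1 + 1)
      (fun b : ↥(pbox (towerTorus Lc (fine Lc M) (n + 1))) × Fin (3 + 1) =>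
        perF (towerTorus Lc (fine Lc M) (n + 1)) (AN (Roots.ctr Lc) (n + 1)) (b.1, Sum.inl b.2)
          (wrapPt (towerTorus Lc (fine Lc M) (n + 1)) (((Lc ^ (n + 1 + 1) : ℕ) : ℤ) • yN a), Sum.inr (μN a))) := by
  rw [Qprime1_eq_compIns1Sym_along_sum M n c hc hv lv 𝔔₀ (Q0_eq_compRowsSym M n Q₁₀ hQ₁₀ Q₂₀ hQ₂₀ 𝔔₀ h𝔔₀) 𝔔₁f
      (Qf1_eq_compIns1Sym M n c Q₁₀ hQ₁₀ Q₂₀ hQ₂₀ hv Q₁₁f hQ₁₁f Q₂₁f hQ₂₁f 𝔔₁f h𝔔₁) Xbf hXbf 𝔔'₁f h𝔔'₁f,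
    direction_add_exact_eq_smul_col M n yN μN hv hhvl lv hlv hJW r a]
  -- leaf-02's homogeneity of the jet, READ at the wrapper's spelling of the finest torus
  have hsm : ∀ h : ↥(pbox (towerTorus Lc (fine Lc M) (n + 1))) × Fin (3 + 1) → ℝ,
      compIns₁Sym Lc M (fun i : ℕ => n + 1 - (i - 1)) (fun _ : ℕ => ctrOff (3 + 1) Lc) (n + 1 + 1) (r • h)
        = r • compIns₁Sym Lc M (fun i : ℕ => n + 1 - (i - 1)) (fun _ : ℕ => ctrOff (3 + 1) Lc) (n + 1 + 1) h :=
    fun h => compIns₁Sym_smul Lc (n + 1 + 1) M (fun i : ℕ => n + 1 - (i - 1)) (fun _ : ℕ => ctrOff (3 + 1) Lc) r h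
  rw [hsm, smul_smul]

omit [Fintype κ] in
include hhvl hlv hJW hQ₁₀ hQ₂₀ hQ₁₁f hQ₂₁f h𝔔₀ h𝔔₁ hXbf h𝔔'₁f hfN hr hcVH in
/-- [folklore] **`hQN1_of_road_data` — THE ROW `hQN₁` AT THE DIRECTION `(μN a, yN a)`, FROM THE ROAD's DATA**: for v4's 𝔔-side namings (values at `v := r•e_a`, `Xbf`
instantiated at the iterated centred root, slot map `fN`), **`𝔔′₁f (r•e_a) = (perF T (dper T (VN (Roots.ctr Lc) Pn (n+1) (μN a) (yN a)))).submatrix fN (·♭)`** — §2's column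
form, F4-Sym with `Σ_full` out (§3), the slot bridge, an2 PART 11's fold, PART 12's `inr∕inl` block, and the scalar `c·r·Σ_full = Pn.cVH (n+2)` (`hr` + `hcVH`). -/
theorem hQN1_of_road_data :
    𝔔'₁f (r • (Pi.single a (1 : ℝ) : κ → ℝ))
      = (perF (towerTorus Lc (fine Lc M) (n + 1)) (dper (towerTorus Lc (fine Lc M) (n + 1)) (VN (Roots.ctr Lc) P (n + 1) (μN a) (yN a)))).submatrix fN
          (fun b : (↥(pbox (towerTorus Lc (fine Lc M) (n + 1))) × Fin (3 + 1)) => ((b.1, Sum.inl b.2) : Idx (towerTorus Lc (fine Lc M) (n + 1)) (Fib 3))) := by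
  have hmN : ∀ a' : ↥(pbox M) × Fin (3 + 1), ∃ m : Fin (3 + 1), (fN a').2 = Sum.inr m := fun a' => ⟨a'.2, by rw [hfN a']⟩
  rw [Qprime1_eq_smul_compIns1Sym_col M n c hc yN μN hv hhvl lv hlv hJW Q₁₀ hQ₁₀ Q₂₀ hQ₂₀ Q₁₁f hQ₁₁f Q₂₁f hQ₂₁f 𝔔₀ h𝔔₀ 𝔔₁f h𝔔₁ Xbf hXbf 𝔔'₁f h𝔔'₁f r a,
    perF_dper_VN_submatrix_of_inr_inl (Roots.ctr Lc) P (n + 1) (towerTorus Lc (fine Lc M) (n + 1)) fN hmN (μN a) (yN a)]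
  -- entrywise, with the indices read at the wrapper's spelling of the finest torus
  apply Matrix.ext
  rintro (⟨x, κ₁⟩ : ↥(pbox M) × Fin (3 + 1)) (⟨z, β⟩ : ↥(pbox (towerTorus Lc (fine Lc M) (n + 1))) × Fin (3 + 1))
  -- the left entry: F4-Sym with `Σ_full` out (§3)
  have e1 : ((c * r) • compIns₁Sym Lc M (fun i : ℕ => n + 1 - (i - 1)) (fun _ : ℕ => ctrOff (3 + 1) Lc) (n + 1 + 1)
        (fun b : ↥(pbox (towerTorus Lc (fine Lc M) (n + 1))) × Fin (3 + 1) =>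
          perF (towerTorus Lc (fine Lc M) (n + 1)) (AN (Roots.ctr Lc) (n + 1)) (b.1, Sum.inl b.2)
            (wrapPt (towerTorus Lc (fine Lc M) (n + 1)) (((Lc ^ (n + 1 + 1) : ℕ) : ℤ) • yN a), Sum.inr (μN a)))) (x, κ₁) (z, β)
      = c * r * ((∏ ℓ ∈ range (n + 1 + 1), (stepScale 3 Lc ℓ * ((box (3 + 1) Lc).card : ℝ))) *
          ∑ b' : ↥(pbox (towerTorus Lc (fine Lc M) (n + 1))) × Fin (3 + 1),
            perF (towerTorus Lc (fine Lc M) (n + 1)) (AN (Roots.ctr Lc) (n + 1)) (b'.1, Sum.inl b'.2)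
                (wrapPt (towerTorus Lc (fine Lc M) (n + 1)) (((Lc ^ (n + 1 + 1) : ℕ) : ℤ) • yN a), Sum.inr (μN a)) *
              perZ (towerTorus Lc (fine Lc M) (n + 1)) (dper (towerTorus Lc (fine Lc M) (n + 1))
                (compV (Roots.ctr Lc).r Lc (n + 1 + 1) b'.2 (b'.1 : Site (3 + 1))))
                ((((Lc ^ (n + 1 + 1) : ℕ) : ℤ)) • (x : Site (3 + 1))) (z : Site (3 + 1)) (Sum.inr κ₁) (Sum.inl β)) := by
    rw [Matrix.smul_apply, smul_eq_mul]
    exact congrArg (fun t : ℝ => c * r * t) (compIns1Sym_apply_eq_sigmaFull_mul_sum M n hc _ x κ₁ z β)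
  -- the right entry: the slot bridge and an2 PART 11's fold (§3)
  have e2 : (P.cVH (n + 1 + 1) • (perF (towerTorus Lc (fine Lc M) (n + 1)) (dper (towerTorus Lc (fine Lc M) (n + 1))
        (vertexOfK (AN (Roots.ctr Lc) (n + 1)) (Lc ^ (n + 1 + 1)) (compV (Roots.ctr Lc).r Lc (n + 1 + 1)) (μN a) (yN a)))).submatrix fN
          (fun b : (↥(pbox (towerTorus Lc (fine Lc M) (n + 1))) × Fin (3 + 1)) => ((b.1, Sum.inl b.2) : Idx (towerTorus Lc (fine Lc M) (n + 1)) (Fib 3))))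
          (x, κ₁) (z, β)
      = P.cVH (n + 1 + 1) *
          ∑ b' : ↥(pbox (towerTorus Lc (fine Lc M) (n + 1))) × Fin (3 + 1),
            perF (towerTorus Lc (fine Lc M) (n + 1)) (AN (Roots.ctr Lc) (n + 1)) (b'.1, Sum.inl b'.2)
                (wrapPt (towerTorus Lc (fine Lc M) (n + 1)) (((Lc ^ (n + 1 + 1) : ℕ) : ℤ) • yN a), Sum.inr (μN a)) *
              perZ (towerTorus Lc (fine Lc M) (n + 1)) (dper (towerTorus Lc (fine Lc M) (n + 1))
                (compV (Roots.ctr Lc).r Lc (n + 1 + 1) b'.2 (b'.1 : Site (3 + 1))))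
                ((((Lc ^ (n + 1 + 1) : ℕ) : ℤ)) • (x : Site (3 + 1))) (z : Site (3 + 1)) (Sum.inr κ₁) (Sum.inl β) := by
    rw [Matrix.smul_apply, Matrix.submatrix_apply, smul_eq_mul, ← sum_col_mul_perF_dper_compV_apply M n (μN a) (yN a), hfN (x, κ₁)]
    congr 1
    refine Finset.sum_congr rfl fun b' _ => ?_
    simp only [perF_apply]
    rw [perZ_dper_wrapPt_left]
  refine e1.trans (Eq.trans ?_ e2.symm)
  rw [← mul_assoc, sigmaFull_card_eq, lockVH_scalar c r (P.cE (n + 1 + 1)) (P.cVH (n + 1 + 1)) _ hr hcVH]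

end Row

end Summit.QuantumFields.BalabanUV.Beta.FP.TowerQN1Row

end
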